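import Summits.Ventures.HSemireg.WedgeCarrierVacuum

/-!
# Venture HSemireg — the carrier bridge — GLUE (p4): W-degree independence of the contraction spans S₀, S₁, S₂

HONEST FRAMING. Part of the Lean index of the computation cell `pub-hsemireg` (seat p3; Sunday enclosure of the
FORMULA-N kernel assets of seats th-7 / th-6, ENCLOSURE-PLAN-p3.md).  Finite-dimensional exterior algebra over a field ONLY:
no variety, no cohomology theory, no semiregularity map is constructed here; nothing here says that HC / HC_CM / HC_AV holds;
no Literature fact is declared or used.  The geometric DICTIONARY (why these ranks are the `HT`-side box ranks of the cell's
STRUCTURE.md §1 / theory/FORMULA-N.md) lives in theory/FORMULA-N-th7.md PART B §A.3 / §N and is NOT asserted in Lean.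

seat p4's GLUE (HOME/p4/GLUE-CB-WDegreeIndependence.section.lean v3 sha256/16 85e4ad902d1c6330; farm-checked by p4 appended to th-7's
CarrierBridge v2), VERBATIM as a module in namespace `Summit.Ventures.HSemireg.WedgeBridge`: W-DEGREE INDEPENDENCE — for `Φ_ω` injective and
`g ∈ ⋀ⁿ W` homogeneous, the three contraction spans `S_2, S_1, S_0` of `x = Φ_ω g` are INDEPENDENT (they sit in `Φ_ω(⋀^{n+2} W)`, `Φ_ω(⋀^{n+1} W)`,
`Φ_ω(⋀ⁿ W)`), `S_1 = span₁` and `S_0 = K ∙ x` literally (`S_2 = span` is `S_two_eq`); dictionary instances `gprod_mem`, `iSupIndep_spans_expSum`,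
`iSupIndep_spans_pointPair` — the hypotheses `h₁`/`h₂` of p4's tree theorem `ContractionSpan.finrank_span_map_mul_map` / `contractionRank_box` for
2-secant-type factors, with no by-value input.  (th-7's WedgeC15 v1.3 duplicates `gprod_mem`; by th-7's 17:47:10Z resolution it is kept HERE and dropped
from `WedgeC15Laws.lean`.)
-/

open Module
open CliffordAlgebra (contractLeft)
open ExteriorAlgebra (ι)

namespace Summit.Ventures.HSemireg.WedgeBridge

section Glue

variable {K : Type*} [Field K] {V : Type*} [AddCommGroup V] [Module K V] {L : Submodule K V}

/-- `S_k(Φ_ω g) ⊆ Φ_ω(Λ^{k+n} W)` for `g ∈ Λⁿ W` (`θ ∧ g ∈ Λ^{k+n} W`). -/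
theorem S_Φ_le_map (k : ℕ) {n : ℕ} (ω : ExteriorAlgebra K V) {g : ExteriorAlgebra K (W K L)}
    (hg : g ∈ ⋀[K]^n (W K L)) : S K L k (Φ K L ω g) ≤ (⋀[K]^(k + n) (W K L)).map (Φ K L ω) := by
  rw [S_Φ_eq]
  refine Submodule.map_mono ?_
  rintro _ ⟨θ, rfl⟩
  rw [wedge, LinearMap.comp_apply, Submodule.subtype_apply, LinearMap.mulRight_apply, ExteriorAlgebra.exteriorPower,
    pow_add]
  exact Submodule.mul_mem_mul θ.2 hg

variable (L) in
/-- `S_0(x) = K x`. -/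
theorem S_zero_eq (x : ExteriorAlgebra K V) : S K L 0 x = K ∙ x := by
  rw [S, ExteriorAlgebra.exteriorPower, pow_zero, Submodule.one_eq_span, Submodule.map_span, Set.image_singleton,
    evρ_apply, map_one, Module.End.one_apply]

variable (L) in
/-- `S_1(x) = span₁ ↑L ↑(Ann L) x` (the tree's degree-one contraction span). -/
theorem S_one_eq (x : ExteriorAlgebra K V) :
    S K L 1 x = Summit.Ventures.HSemireg.ContractionSpan.span₁ (L : Set V) (L.dualAnnihilator : Set (Module.Dual K V)) x := by
  apply le_antisymm
  · rw [S, ExteriorAlgebra.exteriorPower, pow_one, Submodule.map_le_iff_le_comap]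
    rintro _ ⟨w, rfl⟩
    rw [Submodule.mem_comap, evρ_apply, ρ_ι, op_apply]
    exact Submodule.add_mem _ (Submodule.subset_span (Or.inl ⟨_, w.1.2, rfl⟩))
      (Submodule.subset_span (Or.inr ⟨_, w.2.2, rfl⟩))
  · rw [Summit.Ventures.HSemireg.ContractionSpan.span₁, Submodule.span_le]
    rintro y (⟨q, hq, rfl⟩ | ⟨θ, hθ, rfl⟩)
    · refine ⟨ι K ((⟨q, hq⟩ : L), (0 : L.dualAnnihilator)), ?_, ?_⟩
      · rw [SetLike.mem_coe, ExteriorAlgebra.exteriorPower, pow_one]; exact LinearMap.mem_range_self _ _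
      · rw [evρ_apply, ρ_ι, op_apply, Submodule.coe_zero, map_zero, LinearMap.zero_apply, add_zero]
    · refine ⟨ι K ((0 : L), (⟨θ, hθ⟩ : L.dualAnnihilator)), ?_, ?_⟩
      · rw [SetLike.mem_coe, ExteriorAlgebra.exteriorPower, pow_one]; exact LinearMap.mem_range_self _ _
      · rw [evρ_apply, ρ_ι, op_apply, Submodule.coe_zero, map_zero, zero_mul, zero_add]

/-- **W-DEGREE INDEPENDENCE.** For `Φ_ω` injective and `g ∈ Λⁿ W`, the spans `S_2, S_1, S_0` of `Φ_ω g` are independent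
(both orderings, as consumed by `ContractionSpan.finrank_span_mul_eq` / `finrank_span_map_mul_map`). -/
theorem iSupIndep_S_of_injective (ω : ExteriorAlgebra K V) (hΦ : Function.Injective (Φ K L ω)) {n : ℕ}
    {g : ExteriorAlgebra K (W K L)} (hg : g ∈ ⋀[K]^n (W K L)) :
    iSupIndep ![S K L 2 (Φ K L ω g), S K L 1 (Φ K L ω g), S K L 0 (Φ K L ω g)] ∧
      iSupIndep ![S K L 0 (Φ K L ω g), S K L 1 (Φ K L ω g), S K L 2 (Φ K L ω g)] := by
  have hG : iSupIndep fun d : ℕ => (⋀[K]^d (W K L)).map (Φ K L ω) :=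
    LinearMap.iSupIndep_map _ hΦ (DirectSum.Decomposition.isInternal fun d : ℕ => ⋀[K]^d (W K L)).submodule_iSupIndep
  have hdown : Function.Injective (fun i : Fin 3 => 2 - (i : ℕ) + n) := by
    intro i j h; apply Fin.ext; have := i.isLt; have := j.isLt; simp only at h; omega
  have hup : Function.Injective (fun i : Fin 3 => (i : ℕ) + n) := by
    intro i j h; apply Fin.ext; simp only at h; omega
  refine ⟨(hG.comp hdown).mono fun i => ?_, (hG.comp hup).mono fun i => ?_⟩
  · fin_cases i
    · exact S_Φ_le_map 2 ω hg
    · exact S_Φ_le_map 1 ω hg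
    · exact S_Φ_le_map 0 ω hg
  · fin_cases i
    · exact S_Φ_le_map 0 ω hg
    · exact S_Φ_le_map 1 ω hg
    · exact S_Φ_le_map 2 ω hg

/-- **The GLUE in the tree's vocabulary**: intrinsic independence of `span / span₁ / K x` (with `Θ` written as the
set-builder `{θ | θ|_L = 0}` of the ContractionSpan files) for `x = Φ_ω g`, `Φ_ω` injective, `g ∈ Λⁿ W`. -/
theorem iSupIndep_spans_of_injective (ω : ExteriorAlgebra K V) (hΦ : Function.Injective (Φ K L ω)) {n : ℕ}
    {g : ExteriorAlgebra K (W K L)} (hg : g ∈ ⋀[K]^n (W K L)) :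
    iSupIndep ![Summit.Ventures.HSemireg.ContractionSpan.span (L : Set V) {θ : Module.Dual K V | ∀ q ∈ L, θ q = 0} (Φ K L ω g),
      Summit.Ventures.HSemireg.ContractionSpan.span₁ (L : Set V) {θ : Module.Dual K V | ∀ q ∈ L, θ q = 0} (Φ K L ω g),
      K ∙ Φ K L ω g] := by
  have hAnn : ((L.dualAnnihilator : Submodule K (Module.Dual K V)) : Set (Module.Dual K V)) =
      {θ : Module.Dual K V | ∀ q ∈ L, θ q = 0} := Set.ext fun θ => Submodule.mem_dualAnnihilator θ
  have h := (iSupIndep_S_of_injective ω hΦ hg).1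
  rw [S_two_eq, S_one_eq, S_zero_eq, hAnn] at h
  exact h

end Glue

section GlueDictionary

variable {K : Type*} [Field K] {n : ℕ} {V : Type*} [AddCommGroup V] [Module K V] (bV : Basis (Fin (n + n)) K V)

/-- `gprod λ k = Π_{a<k} (y_a + λ x_a)` is homogeneous of W-degree `k`. -/
lemma gprod_mem (lam : K) : ∀ k : ℕ, gprod bV lam k ∈ ⋀[K]^k (W K (Lsp bV))
  | 0 => by rw [gprod, ExteriorAlgebra.exteriorPower, pow_zero]; exact Submodule.one_le.mp le_rfl
  | k + 1 => by
    rw [gprod, ExteriorAlgebra.exteriorPower, pow_succ]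
    exact Submodule.mul_mem_mul (gprod_mem lam k)
      (Submodule.add_mem _ (YN_mem bV k) (Submodule.smul_mem _ lam (XN_mem bV k)))

/-- **Exponential classes: the three intrinsic contraction spans of `Σ_i c_i · Π_a (1 + λ_i ℓ_a ∧ m_a)` are independent**
(the hypothesis `h₁`/`h₂` of `ContractionSpan.finrank_span_map_mul_map` for a 2-secant-type factor — no by-value input). -/
theorem iSupIndep_spans_expSum {ι' : Type*} (s : Finset ι') (c lam : ι' → K) :
    iSupIndep ![Summit.Ventures.HSemireg.ContractionSpan.span (Lsp bV : Set V) {θ : Module.Dual K V | ∀ q ∈ Lsp bV, θ q = 0}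
        (∑ i ∈ s, c i • Eprod bV (lam i) n),
      Summit.Ventures.HSemireg.ContractionSpan.span₁ (Lsp bV : Set V) {θ : Module.Dual K V | ∀ q ∈ Lsp bV, θ q = 0}
        (∑ i ∈ s, c i • Eprod bV (lam i) n),
      K ∙ ∑ i ∈ s, c i • Eprod bV (lam i) n] := by
  have h : Φ K (Lsp bV) (vacuum bV) (∑ i ∈ s, c i • gprod bV (lam i) n) = ∑ i ∈ s, c i • Eprod bV (lam i) n := by
    rw [map_sum]
    exact Finset.sum_congr rfl fun i _ => by rw [map_smul, Φ_gprod]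
  rw [← h]
  exact iSupIndep_spans_of_injective _ (Φ_vacuum_injective bV)
    (Submodule.sum_mem _ fun i _ => Submodule.smul_mem _ _ (gprod_mem bV (lam i) n))

/-- **Point pair: the three intrinsic contraction spans of `a·1 + b·(ℓ_0 ∧ ⋯ ∧ ℓ_{n-1}) ∧ ω` are independent.** -/
theorem iSupIndep_spans_pointPair (a b : K) :
    iSupIndep ![Summit.Ventures.HSemireg.ContractionSpan.span (Lsp bV : Set V) {θ : Module.Dual K V | ∀ q ∈ Lsp bV, θ q = 0}
        (algebraMap K _ a + b • (ellprod bV n * vacuum bV)),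
      Summit.Ventures.HSemireg.ContractionSpan.span₁ (Lsp bV : Set V) {θ : Module.Dual K V | ∀ q ∈ Lsp bV, θ q = 0}
        (algebraMap K _ a + b • (ellprod bV n * vacuum bV)),
      K ∙ (algebraMap K _ a + b • (ellprod bV n * vacuum bV))] := by
  have h : Φ K (Lsp bV) (vacuum bV) (a • yprod bV n + b • xprod bV n) =
      algebraMap K _ a + b • (ellprod bV n * vacuum bV) := by
    rw [map_add, map_smul, map_smul, Φ_yprod, Φ_xprod, Algebra.algebraMap_eq_smul_one]
  rw [← h]
  exact iSupIndep_spans_of_injective _ (Φ_vacuum_injective bV)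
    (Submodule.add_mem _ (Submodule.smul_mem _ a (yprod_mem bV n)) (Submodule.smul_mem _ b (xprod_mem bV n)))

end GlueDictionary

section GlueBasis

variable {K : Type*} [Field K] {n : ℕ} {V : Type*} [AddCommGroup V] [Module K V]

/-- **An ADAPTED BASIS exists**: if `dim V = n + n` and `dim L = n` there is a basis `bV` of `V` indexed by `Fin (n + n)` whose
first block spans `L`, i.e. `Lsp bV = L` — so the dictionary (vacuum, `Φ_vacuum_injective`, `finrank_S_…`, the independence
lemmas above) applies to ANY half-dimensional `L`, e.g. `L = H^{0,1} ∩ V₁ ⊆ V₁ = H¹(X)` of a factor. -/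
theorem exists_basis_Lsp_eq [FiniteDimensional K V] (L : Submodule K V) (hV : Module.finrank K V = n + n)
    (hL : Module.finrank K L = n) : ∃ bV : Basis (Fin (n + n)) K V, Lsp bV = L := by
  obtain ⟨C, hLC⟩ := L.exists_isCompl
  have hC : Module.finrank K C = n := by have := Submodule.finrank_add_eq_of_isCompl hLC; omega
  let bL : Basis (Fin n) K L := (Module.finBasis K L).reindex (finCongr hL)
  let bC : Basis (Fin n) K C := (Module.finBasis K C).reindex (finCongr hC)
  refine ⟨((bL.prod bC).map (Submodule.prodEquivOfIsCompl L C hLC)).reindex finSumFinEquiv, ?_⟩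
  have hℓ : ℓ (((bL.prod bC).map (Submodule.prodEquivOfIsCompl L C hLC)).reindex finSumFinEquiv) = fun a => (bL a : V) :=
    funext fun a => by
      simp only [ℓ, Basis.reindex_apply, finSumFinEquiv_symm_apply_castAdd, Basis.map_apply, Basis.prod_apply, Sum.elim_inl,
        Function.comp_apply, LinearMap.inl_apply, Submodule.coe_prodEquivOfIsCompl', Submodule.coe_zero, add_zero]
  unfold Lsp
  rw [hℓ, show (fun a => (bL a : V)) = L.subtype ∘ bL from rfl, Set.range_comp, Submodule.span_image, bL.span_eq,
    Submodule.map_top, Submodule.range_subtype]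

end GlueBasis

end Summit.Ventures.HSemireg.WedgeBridge
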